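import Literature.AlgebraicGeometry.Modules.CechObjects
import Literature.AlgebraicGeometry.Modules.TensorProduct
import Literature.AlgebraicGeometry.Modules.FiniteType
import Mathlib.LinearAlgebra.TensorProduct.Basic
import HarnessLib

/-!
# The localized-sections Čech sheaves `P̌ⁿ(𝓤, F)`: `V ↦ Π_α Γ(X, V ⊓ U_α) ⊗_{Γ(X, U_α)} Γ(F, U_α)`, sheafified,
# with their counit to the Čech sheaves `Čⁿ(𝓤, F)` (Görtz–Wedhorn II, proof of Lemma 22.36 / Thm. 22.35:
# the coherator on an affine; Hartshorne II Prop. 5.2, Cor. 5.5)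

For a scheme `X`, a family of opens `𝓤 = (U_i)_{i ∈ ι}` and an `𝒪_X`-module `F`, the Čech sheaf `Čⁿ(𝓤, F)` of
`Modules/CechObjects` is `V ↦ Π_α Γ(F, V ⊓ U_α)` (`α : Fin (n+1) → ι`, `U_α = face U α`). When the faces `U_α` are
AFFINE, the quasi-coherent module on `U_α` with the same sections as `F|_{U_α}` is `(Γ(F, U_α))~` (the coherator of
`F|_{U_α}`, Görtz–Wedhorn II after Lemma 22.36), whose sections over an affine `V ⊓ U_α` are the base change
`Γ(X, V ⊓ U_α) ⊗_{Γ(X, U_α)} Γ(F, U_α)` (Hartshorne II Prop. 5.2). This file constructs the corresponding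
`𝒪_X`-modules DIRECTLY ON SECTIONS, functorially in `F` and compatibly with the Čech sheaves (so that the Čech
differential carries over, `Modules/CechLocalizedComplex`), with no choice of isomorphism `U_α ≅ Spec Γ(X, U_α)`:

* §1 the pieces `PCech.Piece U n F V α = Γ(X, V ⊓ U_α) ⊗_{Γ(X, U_α)} Γ(F, U_α)` (`Γ(X, V ⊓ U_α)` a
  `Γ(X, U_α)`-module by restriction), their `Γ(X, V ⊓ U_α)`- and `Γ(X, V)`-module structures, pure tensors
  `tmul b m`, restriction `b ⊗ m ↦ b| ⊗ m`, functoriality `b ⊗ m ↦ b ⊗ φ(m)`, face change `b ⊗ m ↦ b| ⊗ m|`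
  (towards a smaller face) and the counit `b ⊗ m ↦ b • m|_{V ⊓ U_α} ∈ Γ(F, V ⊓ U_α)`;
* §2 the presheaf of `𝒪_X`-modules `PCech.presheafMod U n F : V ↦ Π_α Piece U n F V α` (as `Cech.presheafMod`),
  `PCech.presheafMap` (functoriality in `F`), `PCech.counitPresheaf : presheafMod U n F ⟶ Cech.presheafMod U n F`;
* §3 the SHEAF **`PCech.obj U n F`** (sheafification, the tree's `modulesSheafify`), `PCech.toObj` (the unit),
  **`PCech.map U n φ`**, **`PCech.counit U n F : PCech.obj U n F ⟶ Cech.obj U n F`** (adjoint to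
  `counitPresheaf`), naturality `map_counit`, and `toObj_counit` (the counit restricted along the unit is the
  presheaf counit).

Sections of `PCech.obj` over affine opens, its quasi-coherence, and the quasi-isomorphism with `Čⁿ(𝓤, I•)` for a
`Γ`-acyclic complex with quasi-coherent cohomology are in the sequel files. Everything is PROVED (definitions with
bodies + theorems); 0 named facts; instances only on the NEW types `PCech.Piece`, `PCech.Sections` (module
structures by restriction of scalars). Typed for the cell `pub-hodge-ring2` (Stage I (b) of the `D⁺_qc`
comparison) — a research route conditional on HC_CM, not a corollary; nothing in this file refers to it.

## References

* U. Görtz, T. Wedhorn, *Algebraic Geometry II: Cohomology of Schemes*, Springer Spektrum (2023): Lemma 22.36 and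
  the remark following it (the coherator on an affine scheme), Thm. 22.35 (pp. 349–350). [GortzWedhorn2023]
* R. Hartshorne, *Algebraic Geometry*, GTM 52 (1977), II Prop. 5.2, Cor. 5.5 (pp. 110–113), III Lemma 4.2.
  [Hartshorne1977]
* The Stacks Project, Tags 01I7 (quasi-coherent modules on affines), 08D6 (coherator). [StacksProject]
-/

noncomputable section

-- `TopCat.Presheaf`/`Scheme.Modules` are not reducible (as in Mathlib's `AlgebraicGeometry/Modules/Sheaf.lean`).
set_option backward.isDefEq.respectTransparency false

universe u

open CategoryTheory CategoryTheory.Limits Opposite TopologicalSpace AlgebraicGeometry TensorProduct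

namespace Literature.AlgebraicGeometry.Modules

namespace PCech

open Cech

variable {X : Scheme.{u}} {ι : Type u} (U : ι → X.Opens) (n : ℕ) (F : X.Modules)

/-! ## §1 The pieces `Γ(X, V ⊓ U_α) ⊗_{Γ(X, U_α)} Γ(F, U_α)` -/

section Piece

variable (V : X.Opens) (α : Fin (n + 1) → ι)

/-- `Γ(X, V ⊓ U_α)` as a module over `Γ(X, U_α)`, by restriction of scalars along the restriction map
(an instance on the section rings of this shape; there is no other `Γ(X, U_α)`-module structure on them).
[cite: Hartshorne1977, II Prop. 5.2 (p. 110)] -/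
instance baseMod : Module Γ(X, face U α) Γ(X, V ⊓ face U α) :=
  Module.compHom _ (Cech.resO (X := X) (inf_le_right : V ⊓ face U α ≤ face U α))

/-- Unfolding the restricted scalar action: `a • b = a|_{V ⊓ U_α} b`. [cite: Hartshorne1977, II Prop. 5.2 (p. 110)] -/
theorem baseMod_smul_def (a : Γ(X, face U α)) (b : Γ(X, V ⊓ face U α)) :
    a • b = Cech.resO (X := X) (inf_le_right : V ⊓ face U α ≤ face U α) a * b := rfl

/-- The actions of `Γ(X, U_α)` (restricted) and `Γ(X, V ⊓ U_α)` on `Γ(X, V ⊓ U_α)` commute.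
[cite: Hartshorne1977, II Prop. 5.2 (p. 110)] -/
instance smulCommClass_baseMod : SMulCommClass Γ(X, face U α) Γ(X, V ⊓ face U α) Γ(X, V ⊓ face U α) :=
  ⟨fun a b c => by
    change Cech.resO (X := X) _ a * (b * c) = b * (Cech.resO (X := X) _ a * c)
    rw [mul_left_comm]⟩

/-- `Γ(X, U_α) → Γ(X, V ⊓ U_α) → Γ(X, V ⊓ U_α)` is a scalar tower. [cite: Hartshorne1977, II Prop. 5.2 (p. 110)] -/
instance isScalarTower_baseMod : IsScalarTower Γ(X, face U α) Γ(X, V ⊓ face U α) Γ(X, V ⊓ face U α) :=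
  ⟨fun a b c => by
    change Cech.resO (X := X) _ a * b * c = Cech.resO (X := X) _ a * (b * c)
    rw [mul_assoc]⟩

/-- `Γ(F, V ⊓ U_α)` as a module over `Γ(X, U_α)`, by restriction of scalars. [cite: Hartshorne1977, II Prop. 5.2 (p. 110)] -/
instance targetMod : Module Γ(X, face U α) Γ(F, V ⊓ face U α) :=
  Module.compHom _ (Cech.resO (X := X) (inf_le_right : V ⊓ face U α ≤ face U α))

/-- Unfolding the restricted scalar action on `Γ(F, V ⊓ U_α)`. [cite: Hartshorne1977, II Prop. 5.2 (p. 110)] -/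
theorem targetMod_smul_def (a : Γ(X, face U α)) (x : Γ(F, V ⊓ face U α)) :
    a • x = Cech.resO (X := X) (inf_le_right : V ⊓ face U α ≤ face U α) a • x := rfl

/-- `Γ(X, U_α) → Γ(X, V ⊓ U_α) → Γ(F, V ⊓ U_α)` is a scalar tower. [cite: Hartshorne1977, II Prop. 5.2 (p. 110)] -/
instance isScalarTower_targetMod : IsScalarTower Γ(X, face U α) Γ(X, V ⊓ face U α) Γ(F, V ⊓ face U α) :=
  ⟨fun a b x => by
    change (Cech.resO (X := X) (inf_le_right : V ⊓ face U α ≤ face U α) a * b) • x =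
      Cech.resO (X := X) (inf_le_right : V ⊓ face U α ≤ face U α) a • (b • x)
    rw [mul_smul]⟩

/-- **The piece `Γ(X, V ⊓ U_α) ⊗_{Γ(X, U_α)} Γ(F, U_α)`** — the sections over `V ⊓ U_α` of the quasi-coherent
module on the affine `U_α` attached to `Γ(F, U_α)`. [cite: Hartshorne1977, II Prop. 5.2 (p. 110)]
[cite: GortzWedhorn2023, Lemma 22.36 (p. 349)] -/
abbrev Piece : Type u := Γ(X, V ⊓ face U α) ⊗[Γ(X, face U α)] Γ(F, face U α)

/-- The `Γ(X, V)`-module structure on the piece, by restriction of scalars to `Γ(X, V ⊓ U_α)` (which acts on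
the left factor). [cite: Hartshorne1977, II Prop. 5.2 (p. 110)] -/
@[reducible]
def pieceModule : Module Γ(X, V) (Piece U n F V α) :=
  Module.compHom _ (Cech.resO (X := X) (inf_le_left : V ⊓ face U α ≤ V))

variable {U n F V α}

/-- The pure tensor `b ⊗ m`. [cite: Hartshorne1977, II Prop. 5.2 (p. 110)] -/
abbrev tmul (b : Γ(X, V ⊓ face U α)) (m : Γ(F, face U α)) : Piece U n F V α := b ⊗ₜ m

/-- Induction on pieces: zero, pure tensors, sums. [cite: Hartshorne1977, II Prop. 5.2 (p. 110)] -/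
theorem induction_on {P : Piece U n F V α → Prop} (x : Piece U n F V α) (zero : P 0)
    (tmul : ∀ b m, P (tmul (n := n) b m)) (add : ∀ x y, P x → P y → P (x + y)) : P x :=
  TensorProduct.induction_on (motive := P) x zero tmul add

/-- `tmul` is additive in the left factor. [cite: Hartshorne1977, II Prop. 5.2 (p. 110)] -/
theorem add_tmul (b b' : Γ(X, V ⊓ face U α)) (m : Γ(F, face U α)) :
    tmul (n := n) (b + b') m = tmul b m + tmul b' m :=
  TensorProduct.add_tmul b b' m

/-- `tmul` is additive in the right factor. [cite: Hartshorne1977, II Prop. 5.2 (p. 110)] -/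
theorem tmul_add (b : Γ(X, V ⊓ face U α)) (m m' : Γ(F, face U α)) :
    tmul (n := n) b (m + m') = tmul b m + tmul b m' :=
  TensorProduct.tmul_add b m m'

/-- `tmul` is balanced: `(a| * b) ⊗ m = b ⊗ (a • m)`. [cite: Hartshorne1977, II Prop. 5.2 (p. 110)] -/
theorem tmul_smul (a : Γ(X, face U α)) (b : Γ(X, V ⊓ face U α)) (m : Γ(F, face U α)) :
    tmul (n := n) b (a • m) = tmul (Cech.resO (X := X) (inf_le_right : V ⊓ face U α ≤ face U α) a * b) m := by
  change b ⊗ₜ (a • m) = (a • b) ⊗ₜ m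
  rw [TensorProduct.smul_tmul]

/-- The action of `Γ(X, V ⊓ U_α)` on pure tensors. [cite: Hartshorne1977, II Prop. 5.2 (p. 110)] -/
theorem smul_tmul_inf (c b : Γ(X, V ⊓ face U α)) (m : Γ(F, face U α)) :
    c • tmul (n := n) b m = tmul (c * b) m :=
  TensorProduct.smul_tmul' c b m

/-- The action of `Γ(X, V)` on pure tensors: `r • (b ⊗ m) = (r| * b) ⊗ m`. [cite: Hartshorne1977, II Prop. 5.2 (p. 110)] -/
theorem smul_tmul (r : Γ(X, V)) (b : Γ(X, V ⊓ face U α)) (m : Γ(F, face U α)) :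
    (letI := pieceModule U n F V α; r • tmul (n := n) b m) =
      tmul (Cech.resO (X := X) (inf_le_left : V ⊓ face U α ≤ V) r * b) m :=
  smul_tmul_inf _ b m

variable (U n F V α)

/-- Restriction of functions along `W ≤ W` is the identity. [cite: Hartshorne1977, II §1 (p. 61)] -/
theorem resO_self {W : X.Opens} (h : W ≤ W) (b : Γ(X, W)) : Cech.resO (X := X) h b = b := by
  have e : homOfLE h = 𝟙 W := Subsingleton.elim _ _
  change (X.presheaf.map (homOfLE h).op) b = b
  rw [e, op_id, X.presheaf.map_id]
  rfl

/-- `Γ(X, V ⊓ U_α) → Γ(X, W ⊓ U_α)` (restriction) as a `Γ(X, U_α)`-linear map. [cite: Hartshorne1977, II Prop. 5.2 (p. 110)] -/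
def resBase {V W : X.Opens} (h : W ≤ V) (α : Fin (n + 1) → ι) :
    Γ(X, V ⊓ face U α) →ₗ[Γ(X, face U α)] Γ(X, W ⊓ face U α) :=
  { toFun := Cech.resO (X := X) (inf_le_inf_right (face U α) h)
    map_add' := map_add _
    map_smul' := fun a b => by
      change Cech.resO (X := X) _ (Cech.resO (X := X) _ a * b) = Cech.resO (X := X) _ a * Cech.resO (X := X) _ b
      rw [map_mul, Cech.resO_resO] }

/-- **Restriction of pieces** `Piece V α → Piece W α` (`W ≤ V`): `b ⊗ m ↦ b|_{W ⊓ U_α} ⊗ m`.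
[cite: Hartshorne1977, II Prop. 5.2 (p. 110)] -/
def restrictPiece {V W : X.Opens} (h : W ≤ V) (α : Fin (n + 1) → ι) : Piece U n F V α →+ Piece U n F W α :=
  (TensorProduct.map (resBase U n h α) LinearMap.id).toAddMonoidHom

/-- Restriction on pure tensors. [cite: Hartshorne1977, II Prop. 5.2 (p. 110)] -/
@[simp]
theorem restrictPiece_tmul {V W : X.Opens} (h : W ≤ V) (α : Fin (n + 1) → ι) (b : Γ(X, V ⊓ face U α))
    (m : Γ(F, face U α)) :
    restrictPiece U n F h α (tmul b m) = tmul (Cech.resO (X := X) (inf_le_inf_right (face U α) h) b) m :=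
  rfl

/-- Restriction along `V ≤ V` is the identity. [cite: Hartshorne1977, II Prop. 5.2 (p. 110)] -/
theorem restrictPiece_self (h : V ≤ V) (x : Piece U n F V α) : restrictPiece U n F h α x = x := by
  induction x using induction_on with
  | zero => exact map_zero _
  | tmul b m =>
    rw [restrictPiece_tmul, resO_self]
  | add x y hx hy => simp only [map_add, hx, hy]

/-- Restriction is transitive. [cite: Hartshorne1977, II Prop. 5.2 (p. 110)] -/
theorem restrictPiece_restrictPiece {V W Y : X.Opens} (h : W ≤ V) (h' : Y ≤ W) (x : Piece U n F V α) :
    restrictPiece U n F h' α (restrictPiece U n F h α x) = restrictPiece U n F (h'.trans h) α x := by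
  induction x using induction_on with
  | zero => simp only [map_zero]
  | tmul b m => rw [restrictPiece_tmul, restrictPiece_tmul, restrictPiece_tmul, Cech.resO_resO]
  | add x y hx hy => simp only [map_add, hx, hy]

/-- Restriction is semilinear over `Γ(X, V) → Γ(X, W)`. [cite: Hartshorne1977, II Prop. 5.2 (p. 110)] -/
theorem restrictPiece_smul {V W : X.Opens} (h : W ≤ V) (α : Fin (n + 1) → ι) (r : Γ(X, V)) (x : Piece U n F V α) :
    restrictPiece U n F h α (letI := pieceModule U n F V α; r • x) =
      (letI := pieceModule U n F W α; Cech.resO (X := X) h r • restrictPiece U n F h α x) := by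
  letI := pieceModule U n F V α
  letI := pieceModule U n F W α
  induction x using induction_on with
  | zero => rw [smul_zero, map_zero, smul_zero]
  | tmul b m =>
    rw [smul_tmul, restrictPiece_tmul, restrictPiece_tmul, smul_tmul, map_mul, Cech.resO_resO, Cech.resO_resO]
  | add x y hx hy => simp only [smul_add, map_add, hx, hy]

variable {F} {G : X.Modules}

/-- **Functoriality of pieces in the sheaf**: `b ⊗ m ↦ b ⊗ φ(m)`. [cite: Hartshorne1977, II Prop. 5.2 (p. 110)] -/
def mapPiece (φ : F ⟶ G) (V : X.Opens) (α : Fin (n + 1) → ι) : Piece U n F V α →+ Piece U n G V α :=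
  (LinearMap.lTensor Γ(X, V ⊓ face U α) (appLinear φ (face U α))).toAddMonoidHom

/-- Functoriality on pure tensors. [cite: Hartshorne1977, II Prop. 5.2 (p. 110)] -/
@[simp]
theorem mapPiece_tmul (φ : F ⟶ G) (b : Γ(X, V ⊓ face U α)) (m : Γ(F, face U α)) :
    mapPiece U n φ V α (tmul b m) = tmul b (φ.app (face U α) m) :=
  rfl

/-- Functoriality commutes with restriction. [cite: Hartshorne1977, II Prop. 5.2 (p. 110)] -/
theorem restrictPiece_mapPiece {V W : X.Opens} (h : W ≤ V) (φ : F ⟶ G) (x : Piece U n F V α) :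
    restrictPiece U n G h α (mapPiece U n φ V α x) = mapPiece U n φ W α (restrictPiece U n F h α x) := by
  induction x using induction_on with
  | zero => simp only [map_zero]
  | tmul b m => rw [mapPiece_tmul, restrictPiece_tmul, restrictPiece_tmul, mapPiece_tmul]
  | add x y hx hy => simp only [map_add, hx, hy]

/-- Functoriality commutes with the `Γ(X, V)`-action. [cite: Hartshorne1977, II Prop. 5.2 (p. 110)] -/
theorem mapPiece_smul (φ : F ⟶ G) (r : Γ(X, V)) (x : Piece U n F V α) :
    mapPiece U n φ V α (letI := pieceModule U n F V α; r • x) =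
      (letI := pieceModule U n G V α; r • mapPiece U n φ V α x) := by
  letI := pieceModule U n F V α
  letI := pieceModule U n G V α
  induction x using induction_on with
  | zero => rw [smul_zero, map_zero, smul_zero]
  | tmul b m => rw [smul_tmul, mapPiece_tmul, mapPiece_tmul, smul_tmul]
  | add x y hx hy => simp only [smul_add, map_add, hx, hy]

/-- `mapPiece` of the identity. [cite: Hartshorne1977, II Prop. 5.2 (p. 110)] -/
theorem mapPiece_id (x : Piece U n F V α) : mapPiece U n (𝟙 F) V α x = x := by
  induction x using induction_on with
  | zero => exact map_zero _
  | tmul b m => rw [mapPiece_tmul]; rfl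
  | add x y hx hy => simp only [map_add, hx, hy]

/-- `mapPiece` of a composite. [cite: Hartshorne1977, II Prop. 5.2 (p. 110)] -/
theorem mapPiece_comp {H : X.Modules} (φ : F ⟶ G) (ψ : G ⟶ H) (x : Piece U n F V α) :
    mapPiece U n (φ ≫ ψ) V α x = mapPiece U n ψ V α (mapPiece U n φ V α x) := by
  induction x using induction_on with
  | zero => simp only [map_zero]
  | tmul b m => rw [mapPiece_tmul, mapPiece_tmul, mapPiece_tmul]; rfl
  | add x y hx hy => simp only [map_add, hx, hy]

/-- `mapPiece` is additive in the morphism. [cite: Hartshorne1977, II Prop. 5.2 (p. 110)] -/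
theorem mapPiece_add (φ ψ : F ⟶ G) (x : Piece U n F V α) :
    mapPiece U n (φ + ψ) V α x = mapPiece U n φ V α x + mapPiece U n ψ V α x := by
  induction x using induction_on with
  | zero => simp only [map_zero, add_zero]
  | tmul b m =>
    rw [mapPiece_tmul, mapPiece_tmul, mapPiece_tmul, Scheme.Modules.Hom.add_app]
    exact tmul_add b _ _
  | add x y hx hy => simp only [map_add, hx, hy]; abel

variable (F)

/-- **The counit of a piece**: `Γ(X, V ⊓ U_α) ⊗_{Γ(X, U_α)} Γ(F, U_α) → Γ(F, V ⊓ U_α)`, `b ⊗ m ↦ b • m|_{V ⊓ U_α}`.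
[cite: GortzWedhorn2023, Lemma 22.36 (p. 349)] [cite: Hartshorne1977, II Prop. 5.2 (p. 110)] -/
def counitPiece : Piece U n F V α →+ Γ(F, V ⊓ face U α) :=
  (TensorProduct.lift
    (LinearMap.mk₂ Γ(X, face U α)
      (fun (b : Γ(X, V ⊓ face U α)) (m : Γ(F, face U α)) =>
        b • Cech.res F (inf_le_right : V ⊓ face U α ≤ face U α) m)
      (fun b b' m => add_smul b b' _)
      (fun a b m => smul_assoc a b _)
      (fun b m m' => by rw [map_add, smul_add])
      (fun a b m => by
        rw [Cech.res_smul, targetMod_smul_def, smul_smul, smul_smul, mul_comm]))).toAddMonoidHom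

/-- The counit on pure tensors. [cite: GortzWedhorn2023, Lemma 22.36 (p. 349)] -/
@[simp]
theorem counitPiece_tmul (b : Γ(X, V ⊓ face U α)) (m : Γ(F, face U α)) :
    counitPiece U n F V α (tmul b m) = b • Cech.res F (inf_le_right : V ⊓ face U α ≤ face U α) m :=
  rfl

/-- The counit commutes with restriction. [cite: GortzWedhorn2023, Lemma 22.36 (p. 349)] -/
theorem res_counitPiece {V W : X.Opens} (h : W ≤ V) (x : Piece U n F V α) :
    Cech.res F (inf_le_inf_right (face U α) h) (counitPiece U n F V α x) =
      counitPiece U n F W α (restrictPiece U n F h α x) := by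
  induction x using induction_on with
  | zero => simp only [map_zero]
  | tmul b m =>
    rw [counitPiece_tmul, restrictPiece_tmul, counitPiece_tmul, Cech.res_smul, Cech.res_res]
  | add x y hx hy => simp only [map_add, hx, hy]

/-- The counit is `Γ(X, V ⊓ U_α)`-linear. [cite: GortzWedhorn2023, Lemma 22.36 (p. 349)] -/
theorem counitPiece_smul_inf (c : Γ(X, V ⊓ face U α)) (x : Piece U n F V α) :
    counitPiece U n F V α (c • x) = c • counitPiece U n F V α x := by
  induction x using induction_on with
  | zero => rw [smul_zero, map_zero, smul_zero]
  | tmul b m => rw [smul_tmul_inf, counitPiece_tmul, counitPiece_tmul, mul_smul]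
  | add x y hx hy => simp only [smul_add, map_add, hx, hy]

/-- The counit is natural in the sheaf. [cite: GortzWedhorn2023, Lemma 22.36 (p. 349)] -/
theorem counitPiece_mapPiece (φ : F ⟶ G) (x : Piece U n F V α) :
    counitPiece U n G V α (mapPiece U n φ V α x) = φ.app (V ⊓ face U α) (counitPiece U n F V α x) := by
  induction x using induction_on with
  | zero => simp only [map_zero]
  | tmul b m =>
    rw [mapPiece_tmul, counitPiece_tmul, counitPiece_tmul, Scheme.Modules.Hom.app_smul, Cech.app_res]
  | add x y hx hy => simp only [map_add, hx, hy]

end Piece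

/-! ## §2 The presheaf of `𝒪_X`-modules `V ↦ Π_α Piece V α`, its functoriality and the counit presheaf map -/

section Presheaf

/-- The sections over `V`: families `(x_α ∈ Γ(X, V ⊓ U_α) ⊗ Γ(F, U_α))_α`. [cite: Hartshorne1977, III Lemma 4.2 (p. 220)] -/
def Sections (V : X.Opens) : Type u := ∀ α : Fin (n + 1) → ι, Piece U n F V α

/-- Sections over `V` form an abelian group (componentwise). [cite: Hartshorne1977, III Lemma 4.2 (p. 220)] -/
instance sectionsAddCommGroup (V : X.Opens) : AddCommGroup (Sections U n F V) :=
  inferInstanceAs (AddCommGroup (∀ α : Fin (n + 1) → ι, Piece U n F V α))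

/-- The `Γ(X, V)`-module structure on sections (componentwise restriction of scalars).
[cite: Hartshorne1977, III Lemma 4.2 (p. 220)] -/
instance sectionsModule (V : X.Opens) : Module Γ(X, V) (Sections U n F V) :=
  @Pi.module (Fin (n + 1) → ι) (fun α => Piece U n F V α) Γ(X, V) _ _ (fun α => pieceModule U n F V α)

variable {U n F}

/-- Components of a sum. [cite: Hartshorne1977, III Lemma 4.2 (p. 220)] -/
@[simp] theorem add_apply {V : X.Opens} (s t : Sections U n F V) (α : Fin (n + 1) → ι) : (s + t) α = s α + t α := rfl

/-- Components of zero. [cite: Hartshorne1977, III Lemma 4.2 (p. 220)] -/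
@[simp] theorem zero_apply {V : X.Opens} (α : Fin (n + 1) → ι) : (0 : Sections U n F V) α = 0 := rfl

/-- Components of a scalar multiple. [cite: Hartshorne1977, III Lemma 4.2 (p. 220)] -/
theorem smul_apply {V : X.Opens} (r : Γ(X, V)) (s : Sections U n F V) (α : Fin (n + 1) → ι) :
    (r • s) α = (letI := pieceModule U n F V α; r • s α) := rfl

variable (U n F)

/-- Restriction of sections (componentwise). [cite: Hartshorne1977, III Lemma 4.2 (p. 220)] -/
def restrict {V W : X.Opens} (h : W ≤ V) : Sections U n F V →+ Sections U n F W where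
  toFun s α := restrictPiece U n F h α (s α)
  map_zero' := funext fun _ => map_zero _
  map_add' _ _ := funext fun _ => map_add _ _ _

/-- Components of a restricted section. [cite: Hartshorne1977, III Lemma 4.2 (p. 220)] -/
@[simp] theorem restrict_apply {V W : X.Opens} (h : W ≤ V) (s : Sections U n F V) (α : Fin (n + 1) → ι) :
    restrict U n F h s α = restrictPiece U n F h α (s α) := rfl

/-- The presheaf of abelian groups `V ↦ Π_α Piece V α`. [cite: Hartshorne1977, III Lemma 4.2 (p. 220)] -/
def presheafAb : TopCat.Presheaf Ab X where
  obj V := AddCommGrpCat.of (Sections U n F V.unop)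
  map i := AddCommGrpCat.ofHom (restrict U n F i.unop.le)
  map_id V := by
    refine AddCommGrpCat.ext fun s => funext fun α => ?_
    exact restrictPiece_self U n F _ _ _ _
  map_comp i j := by
    refine AddCommGrpCat.ext fun s => funext fun α => ?_
    exact (restrictPiece_restrictPiece U n F _ _ _ _).symm

/-- The restriction maps of `presheafAb` are `restrict`. [cite: Hartshorne1977, III Lemma 4.2 (p. 220)] -/
@[simp] theorem presheafAb_map_apply {V W : (X.Opens)ᵒᵖ} (i : V ⟶ W) (s : Sections U n F V.unop) :
    (presheafAb U n F).map i s = restrict U n F i.unop.le s := rfl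

/-- Restriction of sections is semilinear. [cite: Hartshorne1977, III Lemma 4.2 (p. 220)] -/
theorem restrict_smul {V W : X.Opens} (h : W ≤ V) (r : Γ(X, V)) (s : Sections U n F V) :
    restrict U n F h (r • s) = Cech.resO (X := X) h r • restrict U n F h s := by
  funext α
  rw [restrict_apply, smul_apply, smul_apply, restrict_apply, restrictPiece_smul]

/-- **The presheaf of `𝒪_X`-modules `V ↦ Π_α Γ(X, V ⊓ U_α) ⊗_{Γ(X, U_α)} Γ(F, U_α)`.**
[cite: GortzWedhorn2023, Lemma 22.36 (p. 349)] [cite: Hartshorne1977, III Lemma 4.2 (p. 220)] -/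
def presheafMod : X.PresheafOfModules :=
  @PresheafOfModules.ofPresheaf _ _ X.ringCatSheaf.obj (presheafAb U n F)
    (fun V => sectionsModule U n F V.unop) (fun _ _ i r s => restrict_smul U n F i.unop.le r s)

variable {F} {G : X.Modules}

/-- **Functoriality `P̌ⁿ(𝓤, φ)` at presheaf level** (componentwise `b ⊗ m ↦ b ⊗ φ(m)`).
[cite: GortzWedhorn2023, Lemma 22.36 (p. 349)] -/
def presheafMap (φ : F ⟶ G) : presheafMod U n F ⟶ presheafMod U n G :=
  PresheafOfModules.homMk
    { app := fun V => AddCommGrpCat.ofHom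
        { toFun := fun (s : Sections U n F V.unop) => fun α => mapPiece U n φ V.unop α (s α)
          map_zero' := funext fun _ => map_zero _
          map_add' := fun _ _ => funext fun _ => map_add _ _ _ }
      naturality := fun {V W} i => by
        ext s
        exact funext fun α => (restrictPiece_mapPiece U n α i.unop.le φ (s α)).symm }
    (fun V r s => funext fun α => mapPiece_smul U n V.unop α φ r (s α))

/-- `presheafMap` of the identity. [cite: GortzWedhorn2023, Lemma 22.36 (p. 349)] -/
theorem presheafMap_id : presheafMap U n (𝟙 F) = 𝟙 _ := by
  ext V s
  exact funext fun α => mapPiece_id U n V.unop α (s α)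

/-- `presheafMap` of a composite. [cite: GortzWedhorn2023, Lemma 22.36 (p. 349)] -/
theorem presheafMap_comp {H : X.Modules} (φ : F ⟶ G) (ψ : G ⟶ H) :
    presheafMap U n (φ ≫ ψ) = presheafMap U n φ ≫ presheafMap U n ψ := by
  ext V s
  exact funext fun α => mapPiece_comp U n V.unop α φ ψ (s α)

/-- `presheafMap` is additive. [cite: GortzWedhorn2023, Lemma 22.36 (p. 349)] -/
theorem presheafMap_add (φ ψ : F ⟶ G) : presheafMap U n (φ + ψ) = presheafMap U n φ + presheafMap U n ψ := by
  ext V s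
  exact funext fun α => mapPiece_add U n V.unop α φ ψ (s α)

variable (F)

/-- **The counit `P̌ⁿ(𝓤, F) → Čⁿ(𝓤, F)` at presheaf level**: componentwise `b ⊗ m ↦ b • m|_{V ⊓ U_α}`.
[cite: GortzWedhorn2023, Lemma 22.36 (p. 349)] [cite: Hartshorne1977, III Lemma 4.2 (p. 220)] -/
def counitPresheaf : presheafMod U n F ⟶ Cech.presheafMod U n F :=
  PresheafOfModules.homMk
    { app := fun V => AddCommGrpCat.ofHom
        { toFun := fun (s : Sections U n F V.unop) => fun α => counitPiece U n F V.unop α (s α)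
          map_zero' := funext fun _ => map_zero _
          map_add' := fun _ _ => funext fun _ => map_add _ _ _ }
      naturality := fun {V W} i => by
        ext s
        exact funext fun α => (res_counitPiece U n F α i.unop.le (s α)).symm }
    (fun V r s => funext fun α => by
      change counitPiece U n F V.unop α ((r • s) α) =
        Cech.resO (X := X) (inf_le_left : V.unop ⊓ face U α ≤ V.unop) r • counitPiece U n F V.unop α (s α)
      rw [smul_apply]
      exact counitPiece_smul_inf U n F V.unop α _ (s α))

variable {F}

/-- The presheaf counit is natural in the sheaf. [cite: GortzWedhorn2023, Lemma 22.36 (p. 349)] -/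
theorem presheafMap_counitPresheaf (φ : F ⟶ G) :
    presheafMap U n φ ≫ counitPresheaf U n G = counitPresheaf U n F ≫ (Cech.map U n F φ).val := by
  ext V s
  exact funext fun α => counitPiece_mapPiece U n F V.unop α φ (s α)

end Presheaf

/-! ## §3 The sheaves `P̌ⁿ(𝓤, F)`, their functoriality and the counit to `Čⁿ(𝓤, F)` -/

section Sheaf

/-- **The localized-sections Čech sheaf `P̌ⁿ(𝓤, F)`**: the sheafification of
`V ↦ Π_α Γ(X, V ⊓ U_α) ⊗_{Γ(X, U_α)} Γ(F, U_α)`. [cite: GortzWedhorn2023, Lemma 22.36 (p. 349)]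
[cite: StacksProject, Tag 08D6] -/
def obj : X.Modules := (modulesSheafify X).obj (presheafMod U n F)

/-- The unit `presheafMod U n F ⟶ P̌ⁿ(𝓤, F)` (sheafification). [cite: StacksProject, Tag 08D6] -/
def toObj : presheafMod U n F ⟶ (Scheme.Modules.toPresheafOfModules X).obj (obj U n F) :=
  (modulesSheafifyAdjunction X).unit.app (presheafMod U n F)

variable {F} {G : X.Modules}

/-- **`P̌ⁿ(𝓤, φ)`**: functoriality in the sheaf. [cite: GortzWedhorn2023, Lemma 22.36 (p. 349)] -/
def map (φ : F ⟶ G) : obj U n F ⟶ obj U n G := (modulesSheafify X).map (presheafMap U n φ)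

/-- `P̌ⁿ(𝓤, 𝟙) = 𝟙`. [cite: GortzWedhorn2023, Lemma 22.36 (p. 349)] -/
@[simp] theorem map_id : map U n (𝟙 F) = 𝟙 _ := by
  rw [map, presheafMap_id, CategoryTheory.Functor.map_id]
  rfl

/-- `P̌ⁿ(𝓤, φ ≫ ψ) = P̌ⁿ(𝓤, φ) ≫ P̌ⁿ(𝓤, ψ)`. [cite: GortzWedhorn2023, Lemma 22.36 (p. 349)] -/
theorem map_comp {H : X.Modules} (φ : F ⟶ G) (ψ : G ⟶ H) : map U n (φ ≫ ψ) = map U n φ ≫ map U n ψ := by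
  rw [map, presheafMap_comp, CategoryTheory.Functor.map_comp]; rfl

variable (F)

/-- **The counit `P̌ⁿ(𝓤, F) ⟶ Čⁿ(𝓤, F)`** (adjoint to the presheaf counit along sheafification).
[cite: GortzWedhorn2023, Lemma 22.36 (p. 349)] [cite: Hartshorne1977, III Lemma 4.2 (p. 220)] -/
def counit : obj U n F ⟶ Cech.obj U n F :=
  ((modulesSheafifyAdjunction X).homEquiv (presheafMod U n F) (Cech.obj U n F)).symm
    (show presheafMod U n F ⟶ (Scheme.Modules.toPresheafOfModules X).obj (Cech.obj U n F) from counitPresheaf U n F)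

/-- The counit composed with the unit is the presheaf counit. [cite: StacksProject, Tag 08D6] -/
theorem toObj_counit :
    toObj U n F ≫ (Scheme.Modules.toPresheafOfModules X).map (counit U n F) = counitPresheaf U n F := by
  rw [toObj, counit, ← Adjunction.homEquiv_unit, Equiv.apply_symm_apply]

variable {F}

/-- The unit is natural: `presheafMap φ ≫ toObj = toObj ≫ map φ`. [cite: StacksProject, Tag 08D6] -/
theorem presheafMap_toObj (φ : F ⟶ G) :
    presheafMap U n φ ≫ toObj U n G = toObj U n F ≫ (Scheme.Modules.toPresheafOfModules X).map (map U n φ) :=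
  ((modulesSheafifyAdjunction X).unit.naturality (presheafMap U n φ))

/-- **The counit is natural in the sheaf**: `P̌ⁿ(𝓤, φ) ≫ counit = counit ≫ Čⁿ(𝓤, φ)`.
[cite: GortzWedhorn2023, Lemma 22.36 (p. 349)] -/
theorem map_counit (φ : F ⟶ G) : map U n φ ≫ counit U n G = counit U n F ≫ Cech.map U n F φ := by
  apply ((modulesSheafifyAdjunction X).homEquiv (presheafMod U n F) (Cech.obj U n G)).injective
  rw [Adjunction.homEquiv_unit, Adjunction.homEquiv_unit, Functor.map_comp, Functor.map_comp]
  change toObj U n F ≫ _ ≫ _ = toObj U n F ≫ _ ≫ _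
  rw [← Category.assoc, ← presheafMap_toObj, Category.assoc, toObj_counit, ← Category.assoc, toObj_counit,
    presheafMap_counitPresheaf]
  rfl

end Sheaf

end PCech

end Literature.AlgebraicGeometry.Modules

end
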